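import Summits.ValiantsHypothesis.ValiantsHypothesis.Theorems.LacunarySymmetroidMatrixDescartesCensusDefs

/-!
# `MatrixDescartes` census — DOOR A at `(3,4)`: the EQUAL-DIAGONAL CHART, part 1 — chart identities and the SIMULTANEOUS
# CONGRUENCE-DIAGONALISATION of a real symmetric `3 × 3` pencil with three distinct real generalised eigenvalues

HONEST FRAMING.  Object-search cell `pub-symmetroid`, door-A seat `val-sym-door-p3` (g17); item stmt-ValiantsHypothesis-19980
`DoorA34 = PosRootLawAt 3 4 18` (route item `Theses.LacunarySymmetroid.DoorA34`) is OPEN and asserted nowhere in this file.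
Nothing here bounds `ζ_sym(3,4)`; nothing bears on `MatrixDescartes` (stmt-ValiantsHypothesis-18050) or on `VP ≠ VNP`.

WHY.  The sign layer is void at `(3,4)` (full alternation `V = 19` is realisable by all-indefinite symmetric letters already on
every 3-Sidon support of the width-13 window — located, this seat; `…CensusDoorA34PseudoNineteen` on `(0,2,5,42)`), so an
all-supports argument for the door needs a CHART of the generic net, and the cell's node files (`…NodeForm`, `…NodeFormComplex`,
`…Pentahedral`) record the node identities but state «which nets HAVE node letters is NOT proved here».  This file and its
companion `…EqualDiagonalChartRows` supply that missing completeness statement for the REALLY-SPLIT sector (node classes R4 / R0):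

* §1 the SIGNED EQUAL-DIAGONAL chart `[[ε₀δ, α, β], [α, ε₁δ, γ], [β, γ, ε₂δ]]`, `εᵢ ∈ {±1}`: determinants (`det_signedEqualDiag`,
  `det_equalDiag` = `δ³ − δ(α²+β²+γ²) + 2αβγ`, `det_equalDiag_neg`), the R4 chart as `δ·1 + hollow(α,β,γ)` with the root
  dictionary «`det = 0` iff `−δ` is an eigenvalue of the hollow matrix» (`det_equalDiag_eq_zero_iff`), the HADAMARD dictionary to
  the node form (`equalDiag_hadamard_eq_sum_rankOne`, `det_equalDiag_hadamard`: `det = 16·e₃(ℓ)` with nodes `(1,±1,±1)`), and the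
  R0 chart's non-definiteness (`not_posDef_equalDiag_neg`, `not_posDef_neg_equalDiag_neg` — one direction of the cell's Lemma 13.1);
* §2 **`exists_congr_diagonal_pair`**: real symmetric `B₁, B₂` with `det B₁ ≠ 0` and `det (B₂ − μᵢB₁) = 0` for three distinct reals
  `μᵢ` admit ONE invertible `V` with `V B₁ Vᵀ = diag a`, `V B₂ Vᵀ = diag (μᵢaᵢ)`, all `aᵢ ≠ 0` (eigenvectors are `B₁`- and `B₂`-orthogonal;
  independence by the Vandermonde trick `∑cᵢvᵢ = 0 ⇒ ∑μᵢcᵢvᵢ = 0`).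

No `def`, no `sorry`; all supports (no exponent enters).  [folklore] Simultaneous reduction of a pair of real quadratic forms
(Gantmacher, *Theory of Matrices* vol. II ch. X §6; Uhlig, Linear Algebra Appl. 14 (1976) 189–209); Cayley's four-nodal cubic; elementary.
-/

-- `Summit.ValiantsHypothesis.ValiantsHypothesis.…` repeats a component by the D-0017 layout
-- (single-conjunct summit), which the `dupNamespace` linter flags; the name is mandated.
set_option linter.dupNamespace false

namespace Summit.ValiantsHypothesis.ValiantsHypothesis.Theorems.LacunarySymmetroidMatrixDescartes.Census.EqualDiagonal

open Polynomial Matrix Finset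
open scoped BigOperators

/-! ## 1. The chart and its determinant -/

/-- Determinant of the SIGNED EQUAL-DIAGONAL chart matrix `[[ε₀δ, α, β], [α, ε₁δ, γ], [β, γ, ε₂δ]]` (any commutative ring). [folklore] -/
theorem det_signedEqualDiag {R : Type*} [CommRing R] (ε₀ ε₁ ε₂ δ α β γ : R) :
    (!![ε₀ * δ, α, β; α, ε₁ * δ, γ; β, γ, ε₂ * δ]).det
      = ε₀ * ε₁ * ε₂ * δ ^ 3 - δ * (ε₀ * γ ^ 2 + ε₁ * β ^ 2 + ε₂ * α ^ 2) + 2 * α * β * γ := by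
  simp [Matrix.det_fin_three]
  ring

/-- Class R4 (`ε = (1,1,1)`): `det [[δ,α,β],[α,δ,γ],[β,γ,δ]] = δ³ − δ(α²+β²+γ²) + 2αβγ` — the characteristic polynomial of the
HOLLOW matrix `[[0,α,β],[α,0,γ],[β,γ,0]]` evaluated at `−δ`, up to sign. [folklore] -/
theorem det_equalDiag {R : Type*} [CommRing R] (δ α β γ : R) :
    (!![δ, α, β; α, δ, γ; β, γ, δ]).det = δ ^ 3 - δ * (α ^ 2 + β ^ 2 + γ ^ 2) + 2 * α * β * γ := by
  simp [Matrix.det_fin_three]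
  ring

/-- Class R0 (`ε = (1,1,−1)`): `det [[δ,α,β],[α,δ,γ],[β,γ,−δ]] = −δ³ + δ(α²−β²−γ²) + 2αβγ`. [folklore] -/
theorem det_equalDiag_neg {R : Type*} [CommRing R] (δ α β γ : R) :
    (!![δ, α, β; α, δ, γ; β, γ, -δ]).det = -δ ^ 3 + δ * (α ^ 2 - β ^ 2 - γ ^ 2) + 2 * α * β * γ := by
  simp [Matrix.det_fin_three]
  ring

/-- The R4 chart matrix is `δ·1 + hollow(α,β,γ)`. [folklore] -/
theorem equalDiag_eq_smul_one_add_hollow {R : Type*} [CommRing R] (δ α β γ : R) :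
    (!![δ, α, β; α, δ, γ; β, γ, δ]) = δ • (1 : Matrix (Fin 3) (Fin 3) R) + !![0, α, β; α, 0, γ; β, γ, 0] := by
  ext i j
  fin_cases i <;> fin_cases j <;> simp

/-- **Root dictionary of the R4 chart**: `det [[δ,α,β],[α,δ,γ],[β,γ,δ]] = 0` iff `−δ` is an eigenvalue of the hollow matrix
`[[0,α,β],[α,0,γ],[β,γ,0]]` (over `ℝ`).  So along an R4-chart pencil the positive det-roots are exactly the parameters at which the
`K`-nomial `−δ(t)` meets an eigenvalue branch of the hollow matrix `A(t)`. [folklore] -/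
theorem det_equalDiag_eq_zero_iff (δ α β γ : ℝ) :
    (!![δ, α, β; α, δ, γ; β, γ, δ]).det = 0 ↔ ∃ v : Fin 3 → ℝ, v ≠ 0 ∧ (!![0, α, β; α, 0, γ; β, γ, 0]) *ᵥ v = (-δ) • v := by
  rw [← Matrix.exists_mulVec_eq_zero_iff]
  constructor
  · rintro ⟨v, hv, h⟩
    refine ⟨v, hv, ?_⟩
    rw [equalDiag_eq_smul_one_add_hollow, Matrix.add_mulVec, Matrix.smul_mulVec, Matrix.one_mulVec] at h
    rw [neg_smul, eq_neg_iff_add_eq_zero, add_comm]; exact h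
  · rintro ⟨v, hv, h⟩
    refine ⟨v, hv, ?_⟩
    rw [equalDiag_eq_smul_one_add_hollow, Matrix.add_mulVec, Matrix.smul_mulVec, Matrix.one_mulVec, h, neg_smul,
      add_neg_cancel]

/-- **Hadamard dictionary (R4)**: with `δ = ℓ₀+ℓ₁+ℓ₂+ℓ₃`, `α = ℓ₀+ℓ₁−ℓ₂−ℓ₃`, `β = ℓ₀−ℓ₁+ℓ₂−ℓ₃`, `γ = ℓ₀−ℓ₁−ℓ₂+ℓ₃` the equal-diagonal
matrix is the node combination `∑ᵢ ℓᵢ vᵢvᵢᵀ` over the four real nodes `v = (1,1,1), (1,1,−1), (1,−1,1), (1,−1,−1)`. [folklore] -/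
theorem equalDiag_hadamard_eq_sum_rankOne {R : Type*} [CommRing R] (ℓ₀ ℓ₁ ℓ₂ ℓ₃ : R) :
    (!![ℓ₀ + ℓ₁ + ℓ₂ + ℓ₃, ℓ₀ + ℓ₁ - ℓ₂ - ℓ₃, ℓ₀ - ℓ₁ + ℓ₂ - ℓ₃;
        ℓ₀ + ℓ₁ - ℓ₂ - ℓ₃, ℓ₀ + ℓ₁ + ℓ₂ + ℓ₃, ℓ₀ - ℓ₁ - ℓ₂ + ℓ₃;
        ℓ₀ - ℓ₁ + ℓ₂ - ℓ₃, ℓ₀ - ℓ₁ - ℓ₂ + ℓ₃, ℓ₀ + ℓ₁ + ℓ₂ + ℓ₃] : Matrix (Fin 3) (Fin 3) R)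
      = ℓ₀ • Matrix.vecMulVec ![1, 1, 1] ![1, 1, 1] + ℓ₁ • Matrix.vecMulVec ![1, 1, -1] ![1, 1, -1]
        + ℓ₂ • Matrix.vecMulVec ![1, -1, 1] ![1, -1, 1] + ℓ₃ • Matrix.vecMulVec ![1, -1, -1] ![1, -1, -1] := by
  ext i j
  fin_cases i <;> fin_cases j <;> simp <;> ring

/-- **Hadamard dictionary, determinant**: in the same substitution `det = 16 · e₃(ℓ₀,ℓ₁,ℓ₂,ℓ₃)` — the R4 equal-diagonal chart is
Cayley's four-nodal cubic `e₃` (the net's `…NodeForm` currency) in the gauge where the four real nodes are `(1,±1,±1)`. [folklore] -/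
theorem det_equalDiag_hadamard {R : Type*} [CommRing R] (ℓ₀ ℓ₁ ℓ₂ ℓ₃ : R) :
    (!![ℓ₀ + ℓ₁ + ℓ₂ + ℓ₃, ℓ₀ + ℓ₁ - ℓ₂ - ℓ₃, ℓ₀ - ℓ₁ + ℓ₂ - ℓ₃;
        ℓ₀ + ℓ₁ - ℓ₂ - ℓ₃, ℓ₀ + ℓ₁ + ℓ₂ + ℓ₃, ℓ₀ - ℓ₁ - ℓ₂ + ℓ₃;
        ℓ₀ - ℓ₁ + ℓ₂ - ℓ₃, ℓ₀ - ℓ₁ - ℓ₂ + ℓ₃, ℓ₀ + ℓ₁ + ℓ₂ + ℓ₃] : Matrix (Fin 3) (Fin 3) R).det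
      = 16 * (ℓ₀ * ℓ₁ * ℓ₂ + ℓ₀ * ℓ₁ * ℓ₃ + ℓ₀ * ℓ₂ * ℓ₃ + ℓ₁ * ℓ₂ * ℓ₃) := by
  simp [Matrix.det_fin_three]
  ring

/-- **The R0 chart takes no definite value**: `[[δ,α,β],[α,δ,γ],[β,γ,−δ]]` is never positive definite (its diagonal carries `δ` and
`−δ`) … [folklore] -/
theorem not_posDef_equalDiag_neg (δ α β γ : ℝ) : ¬ (!![δ, α, β; α, δ, γ; β, γ, -δ]).PosDef := by
  intro h
  have h0 := h.dotProduct_mulVec_pos (x := Pi.single 0 1) (by simp)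
  have h2 := h.dotProduct_mulVec_pos (x := Pi.single 2 1) (by simp)
  simp [Matrix.mulVec, dotProduct, Pi.single_apply] at h0 h2
  linarith

/-- … and neither is its negative: every matrix of an R0-chart net is non-definite (this is the chart form of the cell's Lemma 13.1
«class R0 ⟺ the net has no definite member», one direction). [folklore] -/
theorem not_posDef_neg_equalDiag_neg (δ α β γ : ℝ) : ¬ (-!![δ, α, β; α, δ, γ; β, γ, -δ]).PosDef := by
  intro h
  have h0 := h.dotProduct_mulVec_pos (x := Pi.single 0 1) (by simp)
  have h2 := h.dotProduct_mulVec_pos (x := Pi.single 2 1) (by simp)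
  simp [Matrix.mulVec, dotProduct, Pi.single_apply] at h0 h2
  linarith

/-! ## 2. Simultaneous congruence-diagonalisation of a real symmetric `3 × 3` pencil with three distinct real generalised eigenvalues -/

/-- Entries of `V B Vᵀ` for the matrix `V` with ROWS `v i`: `(V B Vᵀ) i j = v i ⬝ (B v j)`. [folklore] -/
theorem of_mul_mul_transpose_apply (v : Fin 3 → Fin 3 → ℝ) (B : Matrix (Fin 3) (Fin 3) ℝ) (i j : Fin 3) :
    (Matrix.of v * B * (Matrix.of v)ᵀ) i j = v i ⬝ᵥ (B *ᵥ v j) := by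
  simp only [Matrix.mul_assoc]
  simp only [Matrix.mul_apply, Matrix.transpose_apply, Matrix.of_apply, dotProduct, Matrix.mulVec]

/-- `c ᵥ* V = ∑ i, c i • v i` for the matrix `V` with rows `v i`. [folklore] -/
theorem vecMul_of_eq_sum_smul (c : Fin 3 → ℝ) (v : Fin 3 → Fin 3 → ℝ) :
    c ᵥ* Matrix.of v = ∑ i, c i • v i := by
  ext r
  simp [Matrix.vecMul, dotProduct, Finset.sum_apply, Pi.smul_apply]

/-- `B (∑ eᵢ vᵢ) = ∑ eᵢ B vᵢ`. [folklore] -/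
theorem mulVec_sum_smul_three (B : Matrix (Fin 3) (Fin 3) ℝ) (e : Fin 3 → ℝ) (v : Fin 3 → Fin 3 → ℝ) :
    B *ᵥ (∑ i, e i • v i) = ∑ i, e i • (B *ᵥ v i) := by
  simp only [Fin.sum_univ_three, Matrix.mulVec_add, Matrix.mulVec_smul]

/-- `tr (diag a · X) = ∑ aᵢ Xᵢᵢ`. [folklore] -/
theorem trace_diagonal_mul_three (a : Fin 3 → ℝ) (X : Matrix (Fin 3) (Fin 3) ℝ) :
    (diagonal a * X).trace = ∑ i, a i * X i i := by
  simp [Matrix.trace, Matrix.diagonal_mul]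

/-- **SIMULTANEOUS DIAGONALISATION BY CONGRUENCE.**  Let `B₁, B₂` be real symmetric `3 × 3` matrices, `det B₁ ≠ 0`, and suppose
`det (B₂ − μᵢ B₁) = 0` for three DISTINCT reals `μ₀, μ₁, μ₂` (three distinct real generalised eigenvalues of the pencil).  Then there
is an invertible `V` (rows = generalised eigenvectors) with `V B₁ Vᵀ = diag a`, `V B₂ Vᵀ = diag (μᵢ aᵢ)`, all `aᵢ ≠ 0`.
Proof: eigenvectors for distinct generalised eigenvalues are `B₁`- and `B₂`-orthogonal; their independence by the Vandermonde trick
`∑ cᵢvᵢ = 0 ⇒ ∑ μᵢcᵢvᵢ = 0` (apply `B₂`, cancel `B₁`). [folklore] Linear algebra (e.g. Gantmacher, *Theory of Matrices* II §X.6); elementary. -/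
theorem exists_congr_diagonal_pair (B₁ B₂ : Matrix (Fin 3) (Fin 3) ℝ) (hB₁ : B₁.IsSymm) (hB₂ : B₂.IsSymm) (hdet : B₁.det ≠ 0)
    (μ : Fin 3 → ℝ) (hμ : Function.Injective μ) (hroot : ∀ i, (B₂ - μ i • B₁).det = 0) :
    ∃ V : Matrix (Fin 3) (Fin 3) ℝ, V.det ≠ 0 ∧ ∃ a : Fin 3 → ℝ, (∀ i, a i ≠ 0) ∧
      V * B₁ * Vᵀ = diagonal a ∧ V * B₂ * Vᵀ = diagonal (fun i => μ i * a i) := by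
  have hex : ∀ i, ∃ w : Fin 3 → ℝ, w ≠ 0 ∧ (B₂ - μ i • B₁) *ᵥ w = 0 := fun i =>
    Matrix.exists_mulVec_eq_zero_iff.mpr (hroot i)
  choose v hv0 hv using hex
  have heig : ∀ i, B₂ *ᵥ v i = μ i • (B₁ *ᵥ v i) := fun i => by
    have h := hv i
    rwa [Matrix.sub_mulVec, Matrix.smul_mulVec, sub_eq_zero] at h
  -- symmetric matrices: `x ⬝ (B y) = y ⬝ (B x)` (cf. `Literature.Geometry.Riemannian.HamiltonODE.quad_comm_of_isSymm`)
  have hsy : ∀ {B : Matrix (Fin 3) (Fin 3) ℝ}, B.IsSymm → ∀ x y : Fin 3 → ℝ, x ⬝ᵥ (B *ᵥ y) = y ⬝ᵥ (B *ᵥ x) :=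
    fun hB x y => by rw [Matrix.dotProduct_mulVec, ← Matrix.mulVec_transpose, hB.eq, dotProduct_comm]
  -- `B₁`-orthogonality of the eigenvectors
  have horth : ∀ i j, i ≠ j → v i ⬝ᵥ (B₁ *ᵥ v j) = 0 := by
    intro i j hij
    have h1 : v i ⬝ᵥ (B₂ *ᵥ v j) = μ j * (v i ⬝ᵥ (B₁ *ᵥ v j)) := by
      rw [heig, dotProduct_smul, smul_eq_mul]
    have h2 : v i ⬝ᵥ (B₂ *ᵥ v j) = μ i * (v i ⬝ᵥ (B₁ *ᵥ v j)) := by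
      rw [hsy hB₂, heig, dotProduct_smul, smul_eq_mul, hsy hB₁]
    have hne : μ i - μ j ≠ 0 := sub_ne_zero.mpr fun h => hij (hμ h)
    have h3 : (μ i - μ j) * (v i ⬝ᵥ (B₁ *ᵥ v j)) = 0 := by rw [sub_mul, ← h2, ← h1, sub_self]
    exact (mul_eq_zero.mp h3).resolve_left hne
  -- the Vandermonde trick: span relations are stable under `cᵢ ↦ μᵢ cᵢ`
  have hcl : ∀ e : Fin 3 → ℝ, (∑ i, e i • v i) = 0 → (∑ i, (μ i * e i) • v i) = 0 := by
    intro e he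
    have h1 : B₁ *ᵥ (∑ i, (μ i * e i) • v i) = 0 := by
      have h2 : B₂ *ᵥ (∑ i, e i • v i) = B₁ *ᵥ (∑ i, (μ i * e i) • v i) := by
        rw [mulVec_sum_smul_three, mulVec_sum_smul_three]
        refine Finset.sum_congr rfl fun i _ => ?_
        rw [heig, smul_smul, mul_comm]
      rw [← h2, he, Matrix.mulVec_zero]
    by_contra hne
    exact hdet (Matrix.exists_mulVec_eq_zero_iff.mp ⟨_, hne, h1⟩)
  set V : Matrix (Fin 3) (Fin 3) ℝ := Matrix.of v with hVdef
  have hVdet : V.det ≠ 0 := by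
    intro hV0
    obtain ⟨c, hc0, hc⟩ := Matrix.exists_vecMul_eq_zero_iff.mpr hV0
    rw [hVdef, vecMul_of_eq_sum_smul] at hc
    have hc1 := hcl c hc
    have hc2 := hcl _ hc1
    -- isolate each coefficient with the quadratic `(μ − μ_k)(μ − μ_l)`
    have key : ∀ j k l : Fin 3, ({j, k, l} : Finset (Fin 3)) = Finset.univ → j ≠ k → j ≠ l →
        c j = 0 := by
      intro j k l hjkl hjk hjl
      have hsum : (∑ i, ((μ i - μ k) * (μ i - μ l) * c i) • v i) = 0 := by
        have e1 : (∑ i, ((μ i - μ k) * (μ i - μ l) * c i) • v i)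
            = (∑ i, (μ i * (μ i * c i)) • v i) - (μ k + μ l) • (∑ i, (μ i * c i) • v i)
              + (μ k * μ l) • (∑ i, c i • v i) := by
          simp only [Finset.smul_sum, smul_smul, ← Finset.sum_sub_distrib, ← Finset.sum_add_distrib, ← sub_smul,
            ← add_smul]
          refine Finset.sum_congr rfl fun i _ => ?_
          congr 1; ring
        rw [e1, hc2, hc1, hc, smul_zero, smul_zero, sub_zero, add_zero]
      have hk : ((μ k - μ k) * (μ k - μ l) * c k) • v k = 0 := by simp
      have hl : ((μ l - μ k) * (μ l - μ l) * c l) • v l = 0 := by simp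
      have hj : ((μ j - μ k) * (μ j - μ l) * c j) • v j = 0 := by
        have hsplit : (∑ i, ((μ i - μ k) * (μ i - μ l) * c i) • v i)
            = ∑ i ∈ ({j, k, l} : Finset (Fin 3)), ((μ i - μ k) * (μ i - μ l) * c i) • v i := by rw [hjkl]
        have hkl : k ≠ l := by
          intro h; subst h
          have : ({j, k, k} : Finset (Fin 3)).card ≤ 2 := by
            calc ({j, k, k} : Finset (Fin 3)).card ≤ ({k, k} : Finset (Fin 3)).card + 1 := Finset.card_insert_le _ _
              _ ≤ 2 := by simp
          rw [hjkl] at this; simp at this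
        rw [hsplit, Finset.sum_insert (by simp [hjk, hjl]), Finset.sum_pair hkl, hk, hl, add_zero, add_zero] at hsum
        exact hsum
      have hfac : (μ j - μ k) * (μ j - μ l) * c j = 0 := by
        rcases smul_eq_zero.mp hj with h | h
        · exact h
        · exact absurd h (hv0 j)
      have h1 : μ j - μ k ≠ 0 := sub_ne_zero.mpr fun h => hjk (hμ h)
      have h2 : μ j - μ l ≠ 0 := sub_ne_zero.mpr fun h => hjl (hμ h)
      rcases mul_eq_zero.mp hfac with h | h
      · rcases mul_eq_zero.mp h with h' | h'
        · exact absurd h' h1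
        · exact absurd h' h2
      · exact h
    apply hc0
    funext j
    fin_cases j
    · exact key 0 1 2 (by decide) (by decide) (by decide)
    · exact key 1 0 2 (by decide) (by decide) (by decide)
    · exact key 2 0 1 (by decide) (by decide) (by decide)
  refine ⟨V, hVdet, fun i => v i ⬝ᵥ (B₁ *ᵥ v i), ?_, ?_, ?_⟩
  · -- `aᵢ ≠ 0`: `det (V B₁ Vᵀ) = ∏ aᵢ ≠ 0`
    have hdiag : V * B₁ * Vᵀ = diagonal (fun i => v i ⬝ᵥ (B₁ *ᵥ v i)) := by
      ext i j
      rw [hVdef, of_mul_mul_transpose_apply]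
      by_cases hij : i = j
      · subst hij; rw [diagonal_apply_eq]
      · rw [diagonal_apply_ne _ hij, horth i j hij]
    have hd : (V * B₁ * Vᵀ).det ≠ 0 := by
      rw [det_mul, det_mul, det_transpose]; exact mul_ne_zero (mul_ne_zero hVdet hdet) hVdet
    rw [hdiag, det_diagonal] at hd
    intro i
    exact (Finset.prod_ne_zero_iff.mp hd) i (Finset.mem_univ i)
  · ext i j
    rw [hVdef, of_mul_mul_transpose_apply]
    by_cases hij : i = j
    · subst hij; rw [diagonal_apply_eq]
    · rw [diagonal_apply_ne _ hij, horth i j hij]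
  · ext i j
    rw [hVdef, of_mul_mul_transpose_apply, heig, dotProduct_smul, smul_eq_mul]
    by_cases hij : i = j
    · subst hij; rw [diagonal_apply_eq]
    · rw [diagonal_apply_ne _ hij, horth i j hij, mul_zero]

end Summit.ValiantsHypothesis.ValiantsHypothesis.Theorems.LacunarySymmetroidMatrixDescartes.Census.EqualDiagonal
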